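import Summits.BirchSwinnertonDyer.BirchSwinnertonDyer.Theorems.ResidualThetaTransportAtTwoThetaLayerLambdaCongruenceAtTwoCuspSpanTwoPrimesPotential
import HarnessLib

/-!
# Route `ResidualThetaTransportAtTwo`, cruxes Kan⁺ (stmt-BirchSwinnertonDyer-20688) / node 27436 / 21437: the potential of an additive
# `𝔽₂`-character of `Γ₀(N)` at every SQUAREFREE level, and the `B₁`-chain on the types whose colevel is prime

Cell `bsd-wall`, lead prover `bsd-wall-rtt-p3` g10 (2026-08-28). THEOREMS ONLY (no `def`, no `sorry`);
`--supports stmt-BirchSwinnertonDyer-20688`; BSD is not proved by this. Generalises `…CuspSpanTwoPrimesPotential` / `…CuspSpanB1GenTwoPrimes`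
§§1–2 from `N = pq` to every squarefree `N` (uniform base vectors `(1, gcd(y, N))`).

* §0 `exists_act_base_of_coprime_factor` — for `N = d·M` and a primitive `(x, y)` with `d ∣ y`, `y` prime to `M`: `(x, y) = γ (1, d)` for a
  `γ ∈ Γ₀(N)` (Bézout, as at level `pq`); `gcd(y, N)` is `Γ₀(N)`-invariant (`intGcd_act_eq`); at a squarefree level `y` is prime to
  `N / gcd(y, N)` (`isCoprime_div_intGcd_of_squarefree`).
* §1 **`exists_potential_squarefree`** — for squarefree `N` and an additive `χ` killing the trace-`±2` elements: a potential `φ`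
  (`φ(γ v) = χ γ + φ v` on primitive `v`) with `φ(0, 1) = φ(1, 0) = 0` and `φ(1, d) = 0` for every `d ∣ N`.
* §2 **`phi_one_eq_zero_of_dvd_of_coprime_prime`** — the `B₁`-CHAIN for a type `d` whose colevel `M = N/d` is PRIME: if `χ` kills `B₁`
  then `φ(1, w) = 0` for every `w` with `d ∣ w`, `M ∤ w` (the move `w ↦ w/(w+1)` raises `w⁻¹ mod M` by one; anchor `φ(1, d) = 0`).
  At `N = pqr` this settles the types `pq`, `pr`, `qr`; the single-prime types (colevel composite) are the open part
  (`Lines/birth-twoprimes.md` §3).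

References: [Manin1972] §1.5–1.6; [Rademacher1929] §1; [Pollack2003] Conj. 6.3.
-/

set_option autoImplicit false
set_option linter.dupNamespace false

noncomputable section

open scoped MatrixGroups

open CongruenceSubgroup Literature.NumberTheory.EllipticCurves.ModularForms

namespace Summit.BirchSwinnertonDyer.BirchSwinnertonDyer.Theorems.SignedMuAtTwo

namespace Potential

variable {N : ℕ} {χ : Gamma0 N → ZMod 2} {φ : ℤ → ℤ → ZMod 2}

/-! ## §0. Orbit representatives `(1, d)` for a coprime factorisation `N = d·M` -/

/-- **`(x, y) = γ (1, d)`** for `N = d M`, `(x, y)` primitive, `d ∣ y`, `y` prime to `M`: with `m x + n y = 1`, `y = d y'`, `r y + s M = 1`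
take `γ = (x − b d, b; N (y' − m) s, m + (y' − m) r y)`, `b = −n + (y' − m) r x`. [folklore] -/
theorem exists_act_base_of_coprime_factor {d M : ℕ} (hN : N = d * M) {x y : ℤ} (hxy : IsCoprime x y)
    (hdy : (d : ℤ) ∣ y) (hyM : IsCoprime y (M : ℤ)) :
    ∃ γ : Gamma0 N, (γ : SL(2, ℤ)) 0 0 * 1 + (γ : SL(2, ℤ)) 0 1 * d = x ∧
      (γ : SL(2, ℤ)) 1 0 * 1 + (γ : SL(2, ℤ)) 1 1 * d = y := by
  obtain ⟨m, n, hmn⟩ := hxy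
  obtain ⟨y', hy'⟩ := hdy
  obtain ⟨r, s, hrs⟩ := hyM
  have hNz : (N : ℤ) = d * M := by rw [hN]; push_cast; ring
  obtain ⟨γ, h00, h01, h10, h11⟩ := ThetaLayerLambdaCongruenceAtTwo.exists_gamma0_entries (N := N)
    (x - (-n + (y' - m) * r * x) * d) (-n + (y' - m) * r * x) ((N : ℤ) * ((y' - m) * s)) (m + (y' - m) * r * y)
    (by
      rw [hNz]
      linear_combination hmn + (-n + (y' - m) * r * x) * hy' - (-n + (y' - m) * r * x) * d * (y' - m) * hrs)
    (dvd_mul_right _ _)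
  refine ⟨γ, by rw [h00, h01]; ring, ?_⟩
  rw [h10, h11, hNz]
  linear_combination (d : ℤ) * (y' - m) * hrs - hy'

/-- `gcd(c x + d y, N) = gcd(y, N)` for `γ = (a b; c d) ∈ Γ₀(N)` acting on a vector `(x, y)`. [folklore] -/
theorem intGcd_act_eq (γ : Gamma0 N) (x y : ℤ) :
    Int.gcd ((γ : SL(2, ℤ)) 1 0 * x + (γ : SL(2, ℤ)) 1 1 * y) N = Int.gcd y N := by
  have hc : (N : ℤ) ∣ (γ : SL(2, ℤ)) 1 0 := by
    have h := γ.2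
    rw [Gamma0_mem] at h
    exact (ZMod.intCast_zmod_eq_zero_iff_dvd _ N).mp h
  set y' := (γ : SL(2, ℤ)) 1 0 * x + (γ : SL(2, ℤ)) 1 1 * y with hy'
  apply Nat.dvd_antisymm
  · apply Int.natCast_dvd_natCast.mp
    apply Int.dvd_coe_gcd _ (Int.gcd_dvd_right _ _)
    have h1 : ((Int.gcd y' N : ℕ) : ℤ) ∣ (γ : SL(2, ℤ)) 0 0 * y' := dvd_mul_of_dvd_right (Int.gcd_dvd_left _ _) _
    have h2 : ((Int.gcd y' N : ℕ) : ℤ) ∣ (γ : SL(2, ℤ)) 1 0 * ((γ : SL(2, ℤ)) 0 0 * x + (γ : SL(2, ℤ)) 0 1 * y) :=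
      dvd_mul_of_dvd_left (dvd_trans (Int.gcd_dvd_right _ _) hc) _
    have e : (γ : SL(2, ℤ)) 0 0 * y' - (γ : SL(2, ℤ)) 1 0 * ((γ : SL(2, ℤ)) 0 0 * x + (γ : SL(2, ℤ)) 0 1 * y) = y := by
      rw [hy']; linear_combination y * det_entries (γ : SL(2, ℤ))
    rw [← e]
    exact dvd_sub h1 h2
  · apply Int.natCast_dvd_natCast.mp
    apply Int.dvd_coe_gcd _ (Int.gcd_dvd_right _ _)
    exact dvd_add (dvd_mul_of_dvd_left (dvd_trans (Int.gcd_dvd_right _ _) hc) _)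
      (dvd_mul_of_dvd_right (Int.gcd_dvd_left _ _) _)

/-- At a squarefree level, `y` is prime to `N / gcd(y, N)`. [folklore] -/
theorem isCoprime_div_intGcd_of_squarefree (hsq : Squarefree N) (y : ℤ) :
    IsCoprime y ((N / Int.gcd y N : ℕ) : ℤ) := by
  rw [Int.isCoprime_iff_gcd_eq_one]
  change Nat.gcd y.natAbs (((N / Int.gcd y N : ℕ) : ℤ)).natAbs = 1
  rw [Int.natAbs_natCast]
  change Nat.Coprime y.natAbs (N / Int.gcd y N)
  apply Nat.coprime_of_dvd
  intro ℓ hℓ hℓy hℓM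
  have hg : Int.gcd y N = Nat.gcd y.natAbs N := rfl
  have hℓN : ℓ ∣ N := dvd_trans hℓM (Nat.div_dvd_of_dvd (hg ▸ Nat.gcd_dvd_right _ _))
  have hℓg : ℓ ∣ Int.gcd y N := hg ▸ Nat.dvd_gcd hℓy hℓN
  have hsqN : ℓ * ℓ ∣ N := by
    have := Nat.mul_dvd_mul hℓg hℓM
    rwa [Nat.mul_div_cancel' (hg ▸ Nat.gcd_dvd_right _ _)] at this
  exact hℓ.one_lt.ne' (Nat.isUnit_iff.mp (hsq ℓ hsqN))

/-- `N = gcd(y, N) · (N / gcd(y, N))`. [folklore] -/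
theorem level_eq_intGcd_mul_div (y : ℤ) : N = Int.gcd y N * (N / Int.gcd y N) :=
  (Nat.mul_div_cancel' (show Int.gcd y N ∣ N from Nat.gcd_dvd_right _ _)).symm

/-! ## §1. The potential at a squarefree level -/

/-- **The potential at a squarefree level.** For squarefree `N` and an additive `χ : Γ₀(N) → 𝔽₂` killing the trace-`±2` elements there
is `φ : ℤ → ℤ → 𝔽₂` with `φ(γ(x,y)) = χ γ + φ(x,y)` for all `γ ∈ Γ₀(N)` and primitive `(x, y)`, normalised by `φ(0,1) = φ(1,0) = 0` and
`φ(1, d) = 0` for every `d ∣ N` (`φ(x, y) := χ γ` for a chosen `γ` carrying `(1, gcd(y, N))` to `(x, y)`). [folklore] -/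
theorem exists_potential_squarefree [NeZero N] (hsq : Squarefree N)
    (hadd : ∀ γ δ : Gamma0 N, χ (γ * δ) = χ γ + χ δ)
    (hsmall : ∀ γ : Gamma0 N, ((γ : SL(2, ℤ)) 0 0 + (γ : SL(2, ℤ)) 1 1).natAbs ≤ 2 → χ γ = 0) :
    ∃ φ : ℤ → ℤ → ZMod 2,
      (∀ (γ : Gamma0 N) (x y : ℤ), IsCoprime x y →
        φ ((γ : SL(2, ℤ)) 0 0 * x + (γ : SL(2, ℤ)) 0 1 * y) ((γ : SL(2, ℤ)) 1 0 * x + (γ : SL(2, ℤ)) 1 1 * y) = χ γ + φ x y) ∧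
      φ 0 1 = 0 ∧ φ 1 0 = 0 ∧ ∀ d : ℕ, d ∣ N → φ 1 d = 0 := by
  classical
  have hex : ∀ x y : ℤ, IsCoprime x y → ∃ γ : Gamma0 N,
      (γ : SL(2, ℤ)) 0 0 * 1 + (γ : SL(2, ℤ)) 0 1 * (Int.gcd y N : ℕ) = x ∧
        (γ : SL(2, ℤ)) 1 0 * 1 + (γ : SL(2, ℤ)) 1 1 * (Int.gcd y N : ℕ) = y :=
    fun x y hxy ↦ exists_act_base_of_coprime_factor (level_eq_intGcd_mul_div y) hxy (Int.gcd_dvd_left _ _)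
      (isCoprime_div_intGcd_of_squarefree hsq y)
  choose! G hG using hex
  refine ⟨fun x y ↦ χ (G x y), ?_, ?_, ?_, ?_⟩
  · intro γ x y hxy
    have hxy' := isCoprime_act γ hxy
    obtain ⟨a0, a1⟩ := hG x y hxy
    obtain ⟨b0, b1⟩ := hG _ _ hxy'
    rw [intGcd_act_eq γ x y] at b0 b1
    exact chi_eq_add_of_act hadd hsmall γ (G x y) (G _ _) (Or.inl one_ne_zero) a0 a1 b0 b1
  · -- `φ(0,1)`: `gcd(1, N) = 1`; `G 0 1` and `T⁻¹ = (1, −1; 0, 1)` both carry `(1, 1)` to `(0, 1)`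
    show χ (G 0 1) = 0
    obtain ⟨a0, a1⟩ := hG 0 1 isCoprime_one_right
    have hg : Int.gcd 1 N = 1 := Int.gcd_one_left _
    rw [hg] at a0 a1
    push_cast at a0 a1
    obtain ⟨e, he00, he01, he10, he11⟩ :=
      ThetaLayerLambdaCongruenceAtTwo.exists_gamma0_entries (N := N) 1 (-1) 0 1 (by ring) (dvd_zero _)
    rw [chi_eq_of_act_eq hadd hsmall (γ := G 0 1) (γ' := e) (x := 1) (y := 1) (Or.inl one_ne_zero)
      (by rw [he00, he01]; linear_combination a0) (by rw [he10, he11]; linear_combination a1)]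
    exact hsmall e (by rw [he00, he11]; rfl)
  · -- `φ(1,0)`: `gcd(0, N) = N`; `G 1 0` and `L_{−N} = (1, 0; −N, 1)` both carry `(1, N)` to `(1, 0)`
    show χ (G 1 0) = 0
    obtain ⟨a0, a1⟩ := hG 1 0 isCoprime_one_left
    have hg : Int.gcd 0 N = N := by rw [Int.gcd_zero_left]; rfl
    rw [hg] at a0 a1
    obtain ⟨e, he00, he01, he10, he11⟩ :=
      ThetaLayerLambdaCongruenceAtTwo.exists_gamma0_entries (N := N) 1 0 (-(N : ℤ)) 1 (by ring) ⟨-1, by ring⟩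
    rw [chi_eq_of_act_eq hadd hsmall (γ := G 1 0) (γ' := e) (x := 1) (y := (N : ℤ)) (Or.inl one_ne_zero)
      (by rw [he00, he01]; linear_combination a0) (by rw [he10, he11]; linear_combination a1)]
    exact hsmall e (by rw [he00, he11]; rfl)
  · -- `φ(1,d)` for `d ∣ N`: `gcd(d, N) = d`, and `G 1 d` fixes `(1, d)`
    intro d hd
    show χ (G 1 d) = 0
    obtain ⟨a0, a1⟩ := hG 1 d isCoprime_one_left
    have hg : Int.gcd (d : ℤ) N = d := by rw [Int.gcd_natCast_natCast]; exact Nat.gcd_eq_left hd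
    rw [hg] at a0 a1
    exact chi_eq_zero_of_fix hsmall (G 1 d) (Or.inl one_ne_zero) (Or.inl rfl) (by rw [a0]; ring) (by rw [a1]; ring)

/-! ## §2. The `B₁`-chain on a type whose colevel is prime -/

section Chain

variable {d M : ℕ}

/-- Type-`d` integers (`d ∣ x`, coprime colevel `M`) with the same image in `ZMod M` have the same `φ(1, ·)`. [folklore] -/
theorem phi_one_eq_of_dvd_of_cast_eq_coprime (hN : N = d * M) (hdM : Nat.Coprime d M)
    (hsmall : ∀ γ : Gamma0 N, ((γ : SL(2, ℤ)) 0 0 + (γ : SL(2, ℤ)) 1 1).natAbs ≤ 2 → χ γ = 0)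
    (hφ : ∀ (γ : Gamma0 N) (x y : ℤ), IsCoprime x y →
      φ ((γ : SL(2, ℤ)) 0 0 * x + (γ : SL(2, ℤ)) 0 1 * y) ((γ : SL(2, ℤ)) 1 0 * x + (γ : SL(2, ℤ)) 1 1 * y) = χ γ + φ x y)
    {x x' : ℤ} (hx : (d : ℤ) ∣ x) (hx' : (d : ℤ) ∣ x') (h : (x : ZMod M) = (x' : ZMod M)) : φ 1 x = φ 1 x' := by
  refine phi_one_eq_of_dvd_sub hsmall hφ ?_
  rw [hN]; push_cast
  exact (Nat.isCoprime_iff_coprime.mpr hdM).mul_dvd (dvd_sub hx hx') ((ZMod.intCast_eq_intCast_iff_dvd_sub x' x M).mp h.symm)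

/-- **The step** (colevel `M` prime): for `d ∣ x`, `x s = 1` in `ZMod M`, `s + 1 ≠ 0`, there is `x₂` with `d ∣ x₂`, `x₂ (s+1) = 1` and
`φ(1, x₂) = φ(1, x)` (`x₂ = 1 − u`, `(x+1)u + Nk = 1`). [cite: Manin1972, §1.6] -/
theorem exists_step_coprime [Fact M.Prime] (hN : N = d * M)
    (hφ : ∀ (γ : Gamma0 N) (x y : ℤ), IsCoprime x y →
      φ ((γ : SL(2, ℤ)) 0 0 * x + (γ : SL(2, ℤ)) 0 1 * y) ((γ : SL(2, ℤ)) 1 0 * x + (γ : SL(2, ℤ)) 1 1 * y) = χ γ + φ x y)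
    (hB1 : ∀ β : Gamma0 N, (β : SL(2, ℤ)) 0 1 = -1 → χ β = 0)
    {x : ℤ} {s : ZMod M} (hx : (d : ℤ) ∣ x) (hs : (x : ZMod M) * s = 1) (hs1 : s + 1 ≠ 0) :
    ∃ x₂ : ℤ, (d : ℤ) ∣ x₂ ∧ (x₂ : ZMod M) * (s + 1) = 1 ∧ φ 1 x₂ = φ 1 x := by
  have hM : M.Prime := Fact.out
  have hq1 : ¬ (M : ℤ) ∣ x + 1 := by
    intro h
    have h0 : ((x + 1 : ℤ) : ZMod M) = 0 := (ZMod.intCast_zmod_eq_zero_iff_dvd _ M).mpr h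
    push_cast at h0
    apply hs1
    have hx1 : (x : ZMod M) = -1 := by linear_combination h0
    rw [hx1] at hs
    linear_combination -hs
  obtain ⟨t, ht⟩ := hx
  have hcop : IsCoprime (x + 1) (N : ℤ) := by
    rw [hN]; push_cast
    refine IsCoprime.mul_right ⟨1, -t, by linear_combination ht⟩ ?_
    exact ((Irreducible.coprime_iff_not_dvd (Nat.prime_iff_prime_int.mp hM).irreducible).mpr hq1).symm
  obtain ⟨u, k, huk⟩ := hcop
  have huk' : (x + 1) * u + N * k = 1 := by linear_combination huk
  refine ⟨1 - u, ?_, ?_, phi_one_one_sub_eq hφ hB1 huk'⟩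
  · have e : 1 - u = x * u + N * k := by linear_combination -1 * huk'
    rw [e, ht, hN]; push_cast
    exact dvd_add ⟨t * u, by ring⟩ ⟨M * k, by ring⟩
  · have hNq : ((N : ℕ) : ZMod M) = 0 := by rw [hN, Nat.cast_mul, ZMod.natCast_self, mul_zero]
    have hu : ((x : ZMod M) + 1) * (u : ZMod M) = 1 := by
      have := congrArg (fun z : ℤ ↦ (z : ZMod M)) huk'
      push_cast at this
      rw [hNq, zero_mul, add_zero] at this
      exact this
    push_cast
    linear_combination (-s) * hu + (u : ZMod M) * hs

/-- A type-`d` integer with prescribed inverse `s ≠ 0` in `ZMod M` (`M` prime, `gcd(d, M) = 1`). [folklore] -/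
theorem exists_coprime_type_of_ne_zero [Fact M.Prime] (hdM : Nat.Coprime d M) {s : ZMod M} (hs : s ≠ 0) :
    ∃ x : ℤ, (d : ℤ) ∣ x ∧ (x : ZMod M) * s = 1 := by
  have hd0 : (d : ZMod M) ≠ 0 := by
    rw [Ne, ZMod.natCast_eq_zero_iff]
    intro h
    have := Nat.Coprime.eq_one_of_dvd hdM.symm h
    exact (Fact.out : M.Prime).one_lt.ne' this
  refine ⟨d * ((((d : ZMod M) * s)⁻¹).val : ℤ), dvd_mul_right _ _, ?_⟩
  push_cast
  rw [ZMod.natCast_zmod_val, mul_assoc, mul_comm _ s, ← mul_assoc]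
  exact mul_inv_cancel₀ (mul_ne_zero hd0 hs)

/-- **The chain** (colevel `M` prime): all type-`d` classes have the `φ(1, ·)` of the class with inverse `1`. [cite: Manin1972, §1.6] -/
theorem phi_one_eq_of_val_coprime [Fact M.Prime] (hN : N = d * M) (hdM : Nat.Coprime d M)
    (hsmall : ∀ γ : Gamma0 N, ((γ : SL(2, ℤ)) 0 0 + (γ : SL(2, ℤ)) 1 1).natAbs ≤ 2 → χ γ = 0)
    (hφ : ∀ (γ : Gamma0 N) (x y : ℤ), IsCoprime x y →
      φ ((γ : SL(2, ℤ)) 0 0 * x + (γ : SL(2, ℤ)) 0 1 * y) ((γ : SL(2, ℤ)) 1 0 * x + (γ : SL(2, ℤ)) 1 1 * y) = χ γ + φ x y)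
    (hB1 : ∀ β : Gamma0 N, (β : SL(2, ℤ)) 0 1 = -1 → χ β = 0)
    {x₁ : ℤ} (hx₁ : (d : ℤ) ∣ x₁) (hs₁ : (x₁ : ZMod M) * 1 = 1) :
    ∀ (k : ℕ) (x : ℤ) (s : ZMod M), (d : ℤ) ∣ x → (x : ZMod M) * s = 1 → s.val = k + 1 → φ 1 x = φ 1 x₁ := by
  intro k
  induction k with
  | zero =>
    intro x s hx hs hval
    have hs' : s = 1 := by
      apply ZMod.val_injective
      rw [hval, ZMod.val_one]
    rw [hs'] at hs
    refine phi_one_eq_of_dvd_of_cast_eq_coprime hN hdM hsmall hφ hx hx₁ ?_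
    rw [mul_one] at hs hs₁
    rw [hs, hs₁]
  | succ k ih =>
    intro x s hx hs hval
    have hs0 : s ≠ 0 := by rintro rfl; rw [mul_zero] at hs; exact zero_ne_one hs
    have hle : (1 : ZMod M).val ≤ s.val := by rw [ZMod.val_one, hval]; omega
    have hval' : (s - 1).val = k + 1 := by rw [ZMod.val_sub hle, hval, ZMod.val_one, Nat.add_sub_cancel]
    have hs'0 : s - 1 ≠ 0 := by
      intro h
      have := congrArg ZMod.val h
      rw [hval', ZMod.val_zero] at this
      omega
    obtain ⟨x', hx', hxs'⟩ := exists_coprime_type_of_ne_zero hdM hs'0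
    obtain ⟨x₂, hx₂, hx₂s, hφ₂⟩ := exists_step_coprime hN hφ hB1 hx' hxs' (by rw [sub_add_cancel]; exact hs0)
    rw [sub_add_cancel] at hx₂s
    have hxx₂ : (x : ZMod M) = (x₂ : ZMod M) := by
      have : ((x : ZMod M) - x₂) * s = 0 := by rw [sub_mul, hs, hx₂s, sub_self]
      exact sub_eq_zero.mp ((mul_eq_zero.mp this).resolve_right hs0)
    rw [phi_one_eq_of_dvd_of_cast_eq_coprime hN hdM hsmall hφ hx hx₂ hxx₂, hφ₂]
    exact ih x' (s - 1) hx' hxs' hval'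

/-- **`φ(1, w) = 0` on a type of prime colevel.** For `N = d·M` with `M` prime, `gcd(d, M) = 1`, the anchor `φ(1, d) = 0`, and `χ`
killing `B₁`: `φ(1, w) = 0` for every `w` with `d ∣ w`, `M ∤ w`. [cite: Manin1972, §1.6] -/
theorem phi_one_eq_zero_of_dvd_of_coprime_prime (hN : N = d * M) (hM : M.Prime) (hdM : Nat.Coprime d M)
    (hsmall : ∀ γ : Gamma0 N, ((γ : SL(2, ℤ)) 0 0 + (γ : SL(2, ℤ)) 1 1).natAbs ≤ 2 → χ γ = 0)
    (hφ : ∀ (γ : Gamma0 N) (x y : ℤ), IsCoprime x y →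
      φ ((γ : SL(2, ℤ)) 0 0 * x + (γ : SL(2, ℤ)) 0 1 * y) ((γ : SL(2, ℤ)) 1 0 * x + (γ : SL(2, ℤ)) 1 1 * y) = χ γ + φ x y)
    (hB1 : ∀ β : Gamma0 N, (β : SL(2, ℤ)) 0 1 = -1 → χ β = 0) (h1d : φ 1 d = 0)
    {w : ℤ} (hw : (d : ℤ) ∣ w) (hMw : ¬ (M : ℤ) ∣ w) : φ 1 w = 0 := by
  haveI : Fact M.Prime := ⟨hM⟩
  obtain ⟨x₁, hx₁, hs₁⟩ := exists_coprime_type_of_ne_zero (d := d) hdM (one_ne_zero : (1 : ZMod M) ≠ 0)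
  have key : ∀ z : ℤ, (d : ℤ) ∣ z → ¬ (M : ℤ) ∣ z → φ 1 z = φ 1 x₁ := by
    intro z hz hMz
    have hz0 : (z : ZMod M) ≠ 0 := by rwa [Ne, ZMod.intCast_zmod_eq_zero_iff_dvd]
    have hval : ((z : ZMod M)⁻¹).val = (((z : ZMod M)⁻¹).val - 1) + 1 := by
      have : ((z : ZMod M)⁻¹).val ≠ 0 := by
        rw [Ne, ZMod.val_eq_zero]; exact inv_ne_zero hz0
      omega
    exact phi_one_eq_of_val_coprime hN hdM hsmall hφ hB1 hx₁ hs₁ _ z (z : ZMod M)⁻¹ hz (mul_inv_cancel₀ hz0) hval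
  have hMd : ¬ (M : ℤ) ∣ (d : ℤ) := by
    intro h
    have h' : M ∣ d := Int.natCast_dvd_natCast.mp h
    exact hM.one_lt.ne' (Nat.Coprime.eq_one_of_dvd hdM.symm h')
  rw [key w hw hMw, ← key d (dvd_refl _) hMd, h1d]

end Chain

end Potential

end Summit.BirchSwinnertonDyer.BirchSwinnertonDyer.Theorems.SignedMuAtTwo

end
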